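import Mathlib
import Literature.AlgebraicGeometry.Resolution.WeightedResolutionDatum
import Literature.AlgebraicGeometry.Resolution.CobordantBlowupGlobal
import Literature.AlgebraicGeometry.Resolution.MarkedIdealsLemmas
import Summits.ResolutionOfSingularities.ResolutionOfSingularities.Theorems.WeightedInvariantDefs
import Summits.ResolutionOfSingularities.ResolutionOfSingularities.Theorems.WeightedInvariantDatumToEmbeddedStrictTransformCharts
import HarnessLib

/-!
# The downstairs centre pulls back to a power of the exceptional ideal on the strict transform

Topic: `Summits/ResolutionOfSingularities/ResolutionOfSingularities/Theorems`. Part (A3) of stub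
`stub_qs_degree` of the line `Sketch` of the crux `Theses.WeightedInvariant.DatumToEmbedded`
(statement `stmt-ResolutionOfSingularities-0572`) of the summit
`Summit.ResolutionOfSingularities.ResolutionOfSingularities`; the stub itself is
`Theorems/WeightedInvariantDatumToEmbeddedDegree.lean`.

Setting (Włodarczyk, arXiv:2203.03090, §2.3.3: the quotient of the cobordant blow-up `B₊` by the
torus is the blow-up of the quotient downstairs). A closed immersion `i : X ⟶ Y`, a morphism
`q : X ⟶ V` presented by a graded atlas `𝒜 : GradedAtlas j f i q` (`Theorems/WeightedInvariantDefs`: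
affine charts `W a ⊆ Y`, `U a ⊆ V` with `X ∩ W a = q⁻¹ U a`, `ℤʲ`-gradings of `Γ(Y, W a)`,
`Γ(V, U a) =` the degree-`0` classes, homogeneous units of all degrees in `e·ℤʲ` near every point),
pieces `Jₙ` of a Rees algebra on `Y` homogeneous on the charts with `Jₙ^e ⊆ J_{en}`, and a scheme
`X'` over `X` (`σX : X' ⟶ X`, the strict transform) with a coordinate `τ : X' ⟶ 𝔸¹` whose ideal
sheaf `E = τ^*(x)` (the exceptional ideal `(t⁻¹)`) satisfies `E^{D'} = J_{D'} · 𝒪_{X'}`. The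
DOWNSTAIRS CENTRE in degree `D` is `K_D := (J_D · 𝒪_X) pushed forward along q` (Mathlib
`IdealSheafData.map`: the sections of `V` whose pull-back lies in `J_D · 𝒪_X`; on a chart, the
degree-`0` part of `J_D R_a`). Then **`E^{eD'} ⊆ K_{eD'} · 𝒪_{X'}`** (`pow_comap_le_comap_map`):
at a point `P` of `X'` over a chart `a` with homogeneous units, `E_P = (τ_P)` is principal, so
`(τ_P^{D'}) = J_{D'} 𝒪_{X',P}` is generated by ONE homogeneous generator `h` of `J_{D'}(W a)`
(local ring: `exists_mem_isUnit_mul`), and `c · h^e ∈ J_{eD'}(W a)` has degree `0` for a homogeneous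
unit `c` of the opposite degree, hence comes from `K_{eD'}(U a)` (`pow_mem_of_span_eq_map`).

* `exists_mem_isUnit_mul` — in a local ring, a principal ideal `(g) = (S)` is generated by a unit
  multiple of `g` lying in `S`;
* `exists_finset_homogeneous_span` — homogeneous ideals of Noetherian graded rings have finite
  homogeneous generating sets;
* `pow_mem_of_span_eq_map` — the ring-level core above;
* `piece_pow_le`, `map_ideal_eq_comap_appLE`, `stalkIdeal_comap` — bookkeeping on ideal sheaves
  (powers of the pieces of a Rees algebra; sections of a push-forward over a chart; stalks of a
  pull-back);
* `pow_comap_le_comap_map` — the inclusion `E^{eD'} ⊆ K_{eD'} · 𝒪_{X'}`, checked on stalks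
  (`le_of_forall_stalkIdeal_le`).

All proofs are glue on Mathlib and the tree; no definitions, no named facts.
-/

noncomputable section

open CategoryTheory CategoryTheory.Limits AlgebraicGeometry TopologicalSpace
open Literature.AlgebraicGeometry.Resolution
open Summit.ResolutionOfSingularities.ResolutionOfSingularities.Theorems

set_option linter.dupNamespace false -- mandated namespace `…Theorems.DatumToEmbedded.<Topic>`

namespace Summit.ResolutionOfSingularities.ResolutionOfSingularities.Theorems.DatumToEmbedded.Degree

universe u

/-! ## Ring level -/

section Ring

/-- **One generator suffices in a local ring**: if a non-empty set `S` generates the principal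
ideal `(g)` of a local ring, some element of `S` is a unit multiple of `g` (write
`g = ∑ cᵢ sᵢ`, `sᵢ = dᵢ g`; either some `cᵢ dᵢ` is a unit, or `1 - ∑ cᵢ dᵢ` is and `g = 0`).
[folklore] -/
theorem exists_mem_isUnit_mul {R : Type*} [CommRing R] [IsLocalRing R] {S : Set R} {g : R}
    (h : Ideal.span S = Ideal.span {g}) (hS : S.Nonempty) :
    ∃ a ∈ S, ∃ d : R, IsUnit d ∧ a = d * g := by
  classical
  have hg : g ∈ Ideal.span S := h ▸ Ideal.mem_span_singleton_self g
  obtain ⟨m, c, s, hsum⟩ := Submodule.mem_span_set'.mp hg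
  have hd : ∀ l, ∃ d : R, (s l : R) = d * g := fun l => by
    have hl : (s l : R) ∈ Ideal.span {g} := h ▸ Ideal.subset_span (s l).2
    obtain ⟨d, hd⟩ := Ideal.mem_span_singleton'.mp hl
    exact ⟨d, hd.symm⟩
  choose d hd using hd
  by_cases hu : IsUnit (∑ l, c l * d l)
  · -- some summand is a unit
    obtain ⟨l, hl⟩ : ∃ l, IsUnit (c l * d l) := by
      by_contra hcon
      push Not at hcon
      have hmem : ∑ l, c l * d l ∈ IsLocalRing.maximalIdeal R :=
        Ideal.sum_mem _ fun l _ => (IsLocalRing.mem_maximalIdeal _).mpr (hcon l)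
      exact (IsLocalRing.mem_maximalIdeal _).mp hmem hu
    exact ⟨s l, (s l).2, d l, isUnit_of_mul_isUnit_right hl, hd l⟩
  · -- `g = 0`
    have hg0 : g = 0 := by
      have h1 : (1 - ∑ l, c l * d l) * g = 0 := by
        rw [sub_mul, one_mul, Finset.sum_mul, sub_eq_zero]
        conv_lhs => rw [← hsum]
        exact Finset.sum_congr rfl fun l _ => by rw [smul_eq_mul, mul_assoc, ← hd]
      exact ((IsLocalRing.isUnit_one_sub_self_of_mem_nonunits _ hu).mul_right_eq_zero).mp h1
    obtain ⟨a, ha⟩ := hS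
    refine ⟨a, ha, 1, isUnit_one, ?_⟩
    have ha' : a ∈ Ideal.span {g} := h ▸ Ideal.subset_span ha
    rw [hg0, Ideal.span_singleton_eq_bot.mpr rfl, Ideal.mem_bot] at ha'
    rw [ha', hg0, mul_zero]

/-- **Homogeneous ideals of a Noetherian graded ring have finite homogeneous generating sets**
(the homogeneous components of a finite generating set). [folklore] -/
theorem exists_finset_homogeneous_span {A M σ : Type*} [CommRing A] [IsNoetherianRing A]
    [DecidableEq M] [AddMonoid M] [SetLike σ A] [AddSubmonoidClass σ A] (𝒜 : M → σ) [GradedRing 𝒜]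
    {J : Ideal A} (hJ : J.IsHomogeneous 𝒜) :
    ∃ S : Finset A, Ideal.span (S : Set A) = J ∧ ∀ a ∈ S, ∃ μ : M, a ∈ 𝒜 μ := by
  classical
  obtain ⟨G, hG⟩ := IsNoetherian.noetherian (R := A) (M := A) J
  refine ⟨G.biUnion fun a => (DirectSum.decompose 𝒜 a).support.image fun μ =>
    (DirectSum.decompose 𝒜 a μ : A), le_antisymm ?_ ?_, ?_⟩
  · rw [Ideal.span_le]
    intro b hb
    simp only [Finset.coe_biUnion, Finset.coe_image, Set.mem_iUnion, Set.mem_image,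
      Finset.mem_coe] at hb
    obtain ⟨a, ha, μ, -, rfl⟩ := hb
    exact hJ μ (hG ▸ Ideal.subset_span ha)
  · rw [← hG, Ideal.span_le]
    intro a ha
    rw [SetLike.mem_coe, ← DirectSum.sum_support_decompose 𝒜 a]
    refine Ideal.sum_mem _ fun μ hμ => Ideal.subset_span ?_
    simp only [Finset.coe_biUnion, Finset.coe_image, Set.mem_iUnion, Set.mem_image, Finset.mem_coe]
    exact ⟨a, ha, μ, hμ, rfl⟩
  · intro b hb
    simp only [Finset.mem_biUnion, Finset.mem_image] at hb
    obtain ⟨a, -, μ, -, rfl⟩ := hb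
    exact ⟨μ, SetLike.coe_mem _⟩

/-- **The ring-level core of (A3).** Let `A` be a Noetherian ring graded by an abelian group `M`,
`θ : A → O` a ring map to a local ring, `J' ⊆ A` homogeneous with `J'^e ⊆ J`, homogeneous units
of every degree in `e·M` available (`c ∈ A_{eχ}` with `θ c` a unit), and `τ ∈ O` with
`(τ^{D'}) = J'·O`. If `θ` maps the degree-`0` part of `J` into an ideal `𝔎` of `O`, then
`τ^{eD'} ∈ 𝔎`: `(τ^{D'})` is generated by `θ h` for ONE homogeneous generator `h ∈ J'` of some
degree `δ` (local ring), and `c h^e ∈ J ∩ A₀` for a unit `c` of degree `-eδ`. [folklore] -/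
theorem pow_mem_of_span_eq_map {A M O : Type*} [CommRing A] [IsNoetherianRing A] [DecidableEq M]
    [AddCommGroup M] (𝒜 : M → AddSubgroup A) [GradedRing 𝒜] [CommRing O] [IsLocalRing O]
    (θ : A →+* O) {J' J : Ideal A} (hJ' : J'.IsHomogeneous 𝒜) {e : ℕ} (hJJ : J' ^ e ≤ J)
    (hunit : ∀ χ : M, ∃ c ∈ 𝒜 (e • χ), IsUnit (θ c)) {τ : O} {D' : ℕ}
    (hτ : Ideal.span {τ ^ D'} = J'.map θ) (𝔎 : Ideal O)
    (h𝔎 : ∀ g ∈ J, g ∈ 𝒜 0 → θ g ∈ 𝔎) : τ ^ (e * D') ∈ 𝔎 := by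
  classical
  obtain ⟨S, hS, hShom⟩ := exists_finset_homogeneous_span 𝒜 hJ'
  rcases S.eq_empty_or_nonempty with hSe | hSne
  · -- `J' = ⊥`
    rcases Nat.eq_zero_or_pos e with rfl | he
    · rw [zero_mul, pow_zero]
      refine h𝔎 1 (hJJ ?_) (SetLike.one_mem_graded 𝒜) |> fun h => by rwa [map_one] at h
      rw [pow_zero, Ideal.one_eq_top]
      exact Submodule.mem_top
    · have hmem : τ ^ D' ∈ J'.map θ := hτ ▸ Ideal.mem_span_singleton_self _
      rw [← hS, hSe, Finset.coe_empty, Ideal.span_empty, Ideal.map_bot, Ideal.mem_bot] at hmem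
      rw [mul_comm, pow_mul, hmem, zero_pow he.ne']
      exact Ideal.zero_mem _
  · have hS' : Ideal.span (θ '' (S : Set A)) = Ideal.span {τ ^ D'} := by
      rw [← Ideal.map_span, hS, hτ]
    obtain ⟨_, ⟨h, hh, rfl⟩, d, hd, hdh⟩ :=
      exists_mem_isUnit_mul hS' ((Finset.coe_nonempty.mpr hSne).image θ)
    obtain ⟨δ, hδ⟩ := hShom h hh
    obtain ⟨c, hc, hcu⟩ := hunit (-δ)
    have hmem : c * h ^ e ∈ J :=
      Ideal.mul_mem_left _ _ (hJJ (Ideal.pow_mem_pow (hS ▸ Ideal.subset_span hh) e))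
    have hdeg : c * h ^ e ∈ 𝒜 0 := by
      have h1 := SetLike.mul_mem_graded hc (SetLike.pow_mem_graded e hδ)
      rwa [smul_neg, neg_add_cancel] at h1
    have h1 := h𝔎 _ hmem hdeg
    rw [map_mul, map_pow, hdh, mul_pow, ← pow_mul, ← mul_assoc, mul_comm D' e] at h1
    exact (Ideal.unit_mul_mem_iff_mem _ (hcu.mul (hd.pow e))).mp h1

end Ring

/-! ## Ideal sheaves: powers of pieces, push-forwards over charts, stalks of pull-backs -/

section Sheaf

/-- Powers of the pieces of a Rees algebra: `Rₙ^e ⊆ R_{en}`. [folklore] -/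
theorem piece_pow_le {Y : Scheme.{u}} (R : ReesAlgebraData Y) (n : ℕ) :
    ∀ e : ℕ, R.piece n ^ e ≤ R.piece (e * n)
  | 0 => by rw [pow_zero, zero_mul, R.piece_zero, Scheme.IdealSheafData.one_eq_top]
  | e + 1 => by
    rw [pow_succ, add_one_mul]
    exact (mul_le_mul' (piece_pow_le R n e) le_rfl).trans (R.piece_mul_le _ _)

/-- **Sections of a push-forward ideal sheaf over a chart**: for `q : X ⟶ V` quasi-compact, an
affine open `U ⊆ V` and an affine open `W = q⁻¹U` of `X`, the sections of `I` pushed forward along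
`q` over `U` are the sections of `V` over `U` pulling back into `I(W)`. [folklore] -/
theorem map_ideal_eq_comap_appLE {X V : Scheme.{u}} (I : X.IdealSheafData) (q : X ⟶ V)
    [QuasiCompact q] (U : V.affineOpens) {W : X.Opens} (hW : IsAffineOpen W)
    (e : W = q ⁻¹ᵁ U) :
    (I.map q).ideal U = (I.ideal ⟨W, hW⟩).comap (q.appLE U W e.le).hom := by
  subst e
  rw [Scheme.IdealSheafData.ideal_map I q U hW, Scheme.Hom.appLE_eq_app]

/-- **Stalks of a pull-back ideal sheaf**: for `g : X ⟶ T`, affine opens `U ⊆ T` and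
`P ∈ V ⊆ g⁻¹U`, the stalk of `g^*L` at `P` is generated by `L(U)` through
`Γ(T, U) → Γ(X, V) → 𝒪_{X,P}`. [folklore] -/
theorem stalkIdeal_comap {X T : Scheme.{u}} (g : X ⟶ T) (L : T.IdealSheafData) (U : T.affineOpens)
    (V : X.affineOpens) (hV : (V : X.Opens) ≤ g ⁻¹ᵁ U) {P : X} (hP : P ∈ (V : X.Opens)) :
    stalkIdeal (L.comap g) P =
      (L.ideal U).map ((X.presheaf.germ V P hP).hom.comp (g.appLE U V hV).hom) := by
  rw [stalkIdeal_eq_map_germ _ V hP, ideal_comap_of_le g L U V hV, Ideal.map_map]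

end Sheaf

/-! ## The inclusion `E^{eD'} ⊆ K_{eD'} · 𝒪_{X'}` -/

section Heart

variable {k : Type} [Field k] {Y X V : Scheme.{0}} (f : Y ⟶ Spec (.of k)) (i : X ⟶ Y)
  [IsClosedImmersion i] (q : X ⟶ V) [QuasiCompact q] {j : ℕ} (𝒜 : GradedAtlas j f i q)
  [IsLocallyNoetherian Y] (JJ : ℕ → Y.IdealSheafData)
  (hhom : ∀ (a : 𝒜.ι) (n : ℕ), letI := 𝒜.gradedRing a;
    ((JJ n).ideal (𝒜.W a)).IsHomogeneous (𝒜.piece a))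
  (hpow : ∀ n e : ℕ, JJ n ^ e ≤ JJ (e * n))
  {X' : Scheme.{0}} (σX : X' ⟶ X)
  (τ : X' ⟶ Spec (CommRingCat.of (Polynomial ReesFiltration.ZZ.{0})))

include hhom hpow in
/-- **The downstairs centre pulls back to a power of the exceptional ideal** (inclusion `⊇` of
(A3); Włodarczyk 2022, §2.3.3). With `E = τ^*(x)` on `X'` over `X`, pieces `Jₙ` homogeneous on the
charts of the atlas with `Jₙ^e ⊆ J_{en}` (`e` the exponent of the atlas), and
`E^{D'} = J_{D'}·𝒪_{X'}`:
`E^{eD'} ⊆ K_{eD'}·𝒪_{X'}` for the downstairs centre `K_D = q_*(J_D·𝒪_X)`. Checked on stalks: at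
`P ∈ X'` over a chart `a` carrying homogeneous units at `σX P`, `E_P = (τ_P)`,
`(τ_P^{D'}) = J_{D'}(W a)·𝒪_P` is generated by one homogeneous `h ∈ J_{D'}(W a)`, and
`c h^e ∈ J_{eD'}(W a) ∩ A₀` — the class of a section of `K_{eD'}` over `U a` — for a unit `c` of the
opposite degree (`pow_mem_of_span_eq_map`). [cite: Wlodarczyk2022, §2.3.3] -/
theorem pow_comap_le_comap_map (D' : ℕ)
    (hE : ((affineBlowup.idealSheaf (Ideal.span {Polynomial.X})).comap τ) ^ D' =
      (JJ D').comap (σX ≫ i)) :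
    ((affineBlowup.idealSheaf (Ideal.span {Polynomial.X})).comap τ) ^ (𝒜.exponent * D') ≤
      (((JJ (𝒜.exponent * D')).comap i).map q).comap (σX ≫ q) := by
  classical
  refine le_of_forall_stalkIdeal_le fun P => ?_
  obtain ⟨a, hxa, hunits⟩ := 𝒜.exists_unit (σX P)
  letI := 𝒜.gradedRing a
  -- an affine neighbourhood `V'` of `P` over the chart
  have hWx : IsAffineOpen (i ⁻¹ᵁ (𝒜.W a : Y.Opens)) := (𝒜.W a).2.preimage i
  have hPW : P ∈ σX ⁻¹ᵁ (i ⁻¹ᵁ (𝒜.W a : Y.Opens)) := hxa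
  obtain ⟨V', hV', hPV', hV'le⟩ := exists_isAffineOpen_mem_and_subset hPW
  have hV'i : V' ≤ (σX ≫ i) ⁻¹ᵁ (𝒜.W a : Y.Opens) := by
    rw [Scheme.Hom.comp_preimage]
    exact hV'le
  have hV'q : V' ≤ (σX ≫ q) ⁻¹ᵁ (𝒜.U a : V.Opens) := by
    rw [Scheme.Hom.comp_preimage, ← 𝒜.preimage_eq a]
    exact hV'le
  -- stalks: `E_P = (τ_P)`, `(E^m)_P = (τ_P^m)`, pull-backs
  have hEpow : ∀ m : ℕ,
      stalkIdeal (((affineBlowup.idealSheaf (Ideal.span {Polynomial.X})).comap τ) ^ m) P =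
        Ideal.span {(X'.presheaf.germ V' P hPV').hom (τ.appLE ⊤ V' le_top
          ((Scheme.ΓSpecIso (CommRingCat.of (Polynomial ReesFiltration.ZZ.{0}))).inv
            Polynomial.X)) ^ m} := fun m => by
    rw [stalkIdeal_pow, stalkIdeal_eq_map_germ _ ⟨V', hV'⟩ hPV',
      StrictTransform.comap_idealSheaf_X_ideal τ ⟨V', hV'⟩, Ideal.map_span, Set.image_singleton,
      Ideal.span_singleton_pow]
  have hJ' := hEpow D'
  rw [hE, stalkIdeal_comap (σX ≫ i) _ (𝒜.W a) ⟨V', hV'⟩ hV'i hPV'] at hJ'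
  rw [hEpow, stalkIdeal_comap (σX ≫ q) _ (𝒜.U a) ⟨V', hV'⟩ hV'q hPV',
    Ideal.span_singleton_le_iff_mem]
  -- the structure maps `Γ(Y, W a) → 𝒪_{X',P}` and `Γ(V, U a) → 𝒪_{X',P}` through `Γ(X, X ∩ W a)`
  have happi : ∀ s : Γ(Y, 𝒜.W a), ((σX ≫ i).appLE (𝒜.W a) V' hV'i).hom s =
      (σX.appLE (i ⁻¹ᵁ (𝒜.W a)) V' hV'le).hom ((i.app (𝒜.W a)).hom s) := fun s => by
    have h := congrArg (fun φ => φ.hom s)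
      (Scheme.Hom.appLE_comp_appLE σX i (𝒜.W a) (i ⁻¹ᵁ (𝒜.W a)) V' le_rfl hV'le)
    simp only [CommRingCat.hom_comp, RingHom.comp_apply, Scheme.Hom.appLE_eq_app] at h
    exact h.symm
  have happq : ∀ c : Γ(V, 𝒜.U a), ((σX ≫ q).appLE (𝒜.U a) V' hV'q).hom c =
      (σX.appLE (i ⁻¹ᵁ (𝒜.W a)) V' hV'le).hom
        ((q.appLE (𝒜.U a) (i ⁻¹ᵁ (𝒜.W a)) (𝒜.preimage_eq a).le).hom c) := fun c => by
    have h := congrArg (fun φ => φ.hom c)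
      (Scheme.Hom.appLE_comp_appLE σX q (𝒜.U a) (i ⁻¹ᵁ (𝒜.W a)) V' (𝒜.preimage_eq a).le hV'le)
    simp only [CommRingCat.hom_comp, RingHom.comp_apply] at h
    exact h.symm
  haveI : IsNoetherianRing Γ(Y, 𝒜.W a) := IsLocallyNoetherian.component_noetherian (𝒜.W a)
  refine pow_mem_of_span_eq_map (𝒜.piece a) _ (hhom a D')
    (J := (JJ (𝒜.exponent * D')).ideal (𝒜.W a)) ?_ ?_ hJ'.symm _ ?_
  · -- `J_{D'}(W a)^e ⊆ J_{eD'}(W a)`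
    have h := Scheme.IdealSheafData.le_def.mp (hpow D' 𝒜.exponent) (𝒜.W a)
    rwa [Scheme.IdealSheafData.ideal_pow, Pi.pow_apply] at h
  · -- homogeneous units of all degrees in `e·ℤʲ`
    intro χ
    obtain ⟨s, hs, hsu⟩ := hunits χ
    refine ⟨s, hs, ?_⟩
    rw [RingHom.comp_apply, happi]
    exact (hsu.map _).map _
  · -- degree-`0` sections of `J_{eD'}(W a)` come from `K_{eD'}(U a)`
    intro g hg hg0
    obtain ⟨c', hc'⟩ := 𝒜.exists_preimage a g hg0
    have hc'K : c' ∈ (((JJ (𝒜.exponent * D')).comap i).map q).ideal (𝒜.U a) := by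
      rw [map_ideal_eq_comap_appLE _ q (𝒜.U a) hWx (𝒜.preimage_eq a),
        Ideal.mem_comap, ideal_comap_of_le i _ (𝒜.W a) ⟨i ⁻¹ᵁ (𝒜.W a), hWx⟩ le_rfl,
        Scheme.Hom.appLE_eq_app]
      change q.appLE (𝒜.U a) (i ⁻¹ᵁ (𝒜.W a)) (𝒜.preimage_eq a).le c' ∈ _
      rw [hc']
      exact Ideal.mem_map_of_mem _ hg
    have hθg : ((X'.presheaf.germ V' P hPV').hom.comp ((σX ≫ i).appLE (𝒜.W a) V' hV'i).hom) g =
        ((X'.presheaf.germ V' P hPV').hom.comp ((σX ≫ q).appLE (𝒜.U a) V' hV'q).hom) c' := by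
      rw [RingHom.comp_apply, RingHom.comp_apply, happi, happq]
      exact congrArg _ (congrArg _ hc'.symm)
    rw [hθg]
    exact Ideal.mem_map_of_mem _ hc'K

end Heart

/-- **Sub-goal `stub_qs_degree_cartier`** registered on the crux item for this helper file of stub
`stub_qs_degree`: the ring-level core of (A3) (`pow_mem_of_span_eq_map` at universe `0`).
[cite: Wlodarczyk2022, §2.3.3] -/
theorem stub_qs_degree_cartier :
    ∀ {A M O : Type} [CommRing A] [IsNoetherianRing A] [DecidableEq M] [AddCommGroup M]
      (𝒜 : M → AddSubgroup A) [GradedRing 𝒜] [CommRing O] [IsLocalRing O] (θ : A →+* O)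
      {J' J : Ideal A}, J'.IsHomogeneous 𝒜 → ∀ {e : ℕ}, J' ^ e ≤ J →
      (∀ χ : M, ∃ c ∈ 𝒜 (e • χ), IsUnit (θ c)) → ∀ {τ : O} {D' : ℕ},
      Ideal.span {τ ^ D'} = J'.map θ → ∀ (𝔎 : Ideal O), (∀ g ∈ J, g ∈ 𝒜 0 → θ g ∈ 𝔎) →
      τ ^ (e * D') ∈ 𝔎 := by
  intro A M O _ _ _ _ 𝒜 _ _ _ θ J' J hJ' e hJJ hunit τ D' hτ 𝔎 h𝔎
  exact pow_mem_of_span_eq_map 𝒜 θ hJ' hJJ hunit hτ 𝔎 h𝔎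

end Summit.ResolutionOfSingularities.ResolutionOfSingularities.Theorems.DatumToEmbedded.Degree

end
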